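import Summits.QuantumFields.YangMills.Theorems.BalabanUVNodesN15KingModelSlicesTorusGrad

/-!
# BalabanUVNodes ∕ N15 — THE KING-MODEL RUNG, CURVED EDITION (PART I): THE `A = 0` TORUS MEMBER WITH ITS GRADIENT — King's single-scale
# piece AND its gradient piece (parts F ∕ H) at two spacings as one `TwoSpacing` datum, (3.73) LINES 1–2 PROVED for it, and NE2's site layer
# for BOTH the slice (`p = −2`) and the gradient slice (`p = −1`) through part E (v1.1), hypothesis-free
# (Track A, DAG node N15 = NE2; FAN-OUT v1.1 §N15 s3 «KING-MODEL RUNG … + the one-line statement of what the curved case adds»)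

HONEST FRAMING.  Count-neutral kernel bookkeeping (cell `pub-ymgap`, seat `pub-ymgap-dag-n15-e` g4; `--supports stmt-QuantumFields-19908
--as helper` = K3′ `SpineGivenEndpointR12`, lineage K3 19676).  TEMPLATE LITERATURE, `A = 0`: King's scalar MODEL on finite tori, the KING-TYPE
single-scale pieces of parts F ∕ H (lattice units; the mass held fixed in scale-`j` units — a MODEL member family, not a transcription of (2.17));
NOT Bałaban's `G(U)`; NE2⁺ for Bałaban's objects is NOT PRINTED and not proved; NOT a node discharge; nothing continuum ∕ ℝ⁴ ∕ OS ∕ mass-gap ∕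
Clay.  0 `sorry`, standard axioms; plumbing `def`s (the datum with gradient, its point fibres, the family map).

THE POINT.  Part G's datum carried the slice kernel only (gradient `0`); part H PROVED the two-spacing rate of the gradient piece
(`ksDSlice_rate`).  THIS PART is the datum WITH GRADIENT and both lines of (3.73) for it:
* §1 **`kSliceDataD L a m² i : TwoSpacing (d+1)`** — part G's runs, distances and point map, slice kernel `G := ksSlice` ∕ `ksSlice′` AND gradient
  kernel `dG := ksDSlice` ∕ `ksDSlice′` at every slice index (the family reads index `j` only); its point fibres `kSlicePBD` (part G's, retyped); the
  family map **`kSliceIndexD : KSliceIdx d → SlicesIndex (d+1)`**;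
* §2 **`line1_kSlicesD`** ((3.73) line 1, as part G, `d ≥ 1`) and **`line2_kSlicesD`** ((3.73) LINE 2 at slice `j`, every index and direction, ONE
  `(C, δ)`, `γ′ = γ∕2`, `0 < γ < 1`): `|∂′G′_{(j)}(x′, y′) − ∂G_{(j)}(x, y)| ≤ C·L^{−γ′k}(L^jη)^{1−(d+1)−γ′}·e^{−δ(L^jη)^{−1}dist(x, y)}` — part H's rate,
  `slice_rate_identity`, and the prefactor `(L^jη)^{−d} ≥ 1` (every `d`);
* §3 THROUGH PART E: `ne2PlusSite_kSlicesD` (slice, `p = −2`, part E `ne2PlusSite_slicesG_of_line1`) and **`ne2PlusSite_kSlicesD_grad`** (gradient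
  slice, `p = −1`, part E v1.1 `ne2PlusSite_slicesDG_of_line2`, constant `(d+1)·C`), `ne2ZeroSite_kSlicesD_grad`, and BOTH AT ONCE
  (`ne2PlusSite_kSlicesD_both`).
WHAT BAŁABAN'S CASE STILL ADDS: as parts D∕F∕G.  HONEST SCOPE: as parts F (i)–(vi) and H (vii)–(viii).
Locators: [King1986] C. King, CMP **102** (1986) 649–677: p. 664 (pairing sentence), Prop. 3.9 (3.73) p. 665 (lines 1–2), (4.42)–(4.43)
p. 675; [B9] = [Balaban1985BackgroundPropagators] Thm 3.2 (3.48) p. 398, (3.132)–(3.133) p. 422, Thm 3.14 pp. 426–427 (typing template).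
-/

noncomputable section

namespace Summit.QuantumFields.YangMills.BalabanUVNodes.N15KingModelRung.Curved

open Real Finset
open Literature.MathematicalPhysics.QuantumFieldTheory.Balaban1983to89.T4EtaRate (EtaRateIneqSite NE2PlusSite)
open Literature.MathematicalPhysics.QuantumFieldTheory.Balaban1983to89.T4EtaRateSiteOfRatePair (NE2ZeroSite ne2ZeroSite_of_ne2PlusSite)
open Literature.MathematicalPhysics.QuantumFieldTheory.Balaban1983to89.B5Prop11Plancherel (Tor fine)
open Literature.MathematicalPhysics.QuantumFieldTheory.King1986.ContinuumLimit (eps eps_pos)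
open Literature.MathematicalPhysics.QuantumFieldTheory.King1986.Torus (blockOf tdistT tdistT_nonneg)
open Literature.MathematicalPhysics.QuantumFieldTheory.King1986.SlicePropagator (SliceKernels TwoSpacing)

variable {d : ℕ}

/-! ## §1 The datum with gradient, its point fibres, the family map -/

section Object

variable (L : ℕ) [NeZero L] (a m2 : ℝ)

/-- THE COARSE RUN'S SLICE DATA WITH GRADIENT: part G's `kSliceLo` with `dG := ` part H's gradient piece `ksDSlice` (at every slice index).
[cite: King1986, (2.17) p.653, Prop. 3.9 (3.73) p.665 (objects of lines 1–2)] -/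
@[reducible] def kSliceLoD (i : KSliceIdx d) : SliceKernels (d + 1) where
  S := Tor (fine (L ^ i.j) (ksU L i))
  B := Unit
  dist := fun x y => ((L : ℝ) ^ i.j * eps L i.k) * tdistT (ksU L i) (blockOf (L ^ i.j) (ksU L i) x) (blockOf (L ^ i.j) (ksU L i) y)
  distBlockBond := fun _ _ _ => 0
  L := L
  k := i.k
  G := fun _ x y => ksSlice L a m2 i x y
  dG := fun _ μ x y => ksDSlice L a m2 i μ x y
  Gc := fun _ _ _ => 0

/-- THE FINE RUN'S SLICE DATA WITH GRADIENT. [cite: King1986, (2.17) p.653, Prop. 3.9 (3.73) p.665 (objects of lines 1–2)] -/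
@[reducible] def kSliceHiD (i : KSliceIdx d) : SliceKernels (d + 1) where
  S := Tor (fine (L ^ i.n * L ^ i.j) (ksU L i))
  B := Unit
  dist := fun x' y' => ((L : ℝ) ^ i.j * eps L i.k)
    * tdistT (ksU L i) (blockOf (L ^ i.n * L ^ i.j) (ksU L i) x') (blockOf (L ^ i.n * L ^ i.j) (ksU L i) y')
  distBlockBond := fun _ _ _ => 0
  L := L
  k := i.k + i.n
  G := fun _ x' y' => ksSlice' L a m2 i x' y'
  dG := fun _ μ x' y' => ksDSlice' L a m2 i μ x' y'
  Gc := fun _ _ _ => 0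

/-- **KING'S `A = 0` SINGLE-SCALE PIECE WITH ITS GRADIENT AT TWO SPACINGS AS THE SCHEMA's `TwoSpacing` DATUM** (King's point map `underPtN`; the
Prop-3.8 legs not instantiated). [cite: King1986, p.664 (two spacings), Prop. 3.9 (3.73) p.665 (objects)] -/
@[reducible] def kSliceDataD (i : KSliceIdx d) : TwoSpacing (d + 1) where
  lo := kSliceLoD L a m2 i
  hi := kSliceHiD L a m2 i
  n := i.n
  k_hi := rfl
  L_hi := rfl
  pt := underPtN L i.j i.n (ksU L i)
  bd := fun b => b
  IsUnit := fun _ => True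
  K := fun _ _ => 0
  dK := fun _ _ _ => 0
  K' := fun _ _ => 0
  dK' := fun _ _ _ => 0

/-- Its point fibres (part G's `kSlicePB`, same sites and point map). [cite: King1986, p.664 («x′ ∈ B^n(x)»)] -/
def kSlicePBD (i : KSliceIdx d) : PointBlocking (kSliceDataD L a m2 i) :=
  ⟨(kSlicePB L a m2 i).fibre, (kSlicePB L a m2 i).mem_fibre, (kSlicePB L a m2 i).fibre_nonempty⟩

/-- THE FAMILY MAP of the datum with gradient into parts D–E's slice index. [folklore] -/
def kSliceIndexD (hL : 2 ≤ L) (i : KSliceIdx d) : SlicesIndex (d + 1) :=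
  ⟨kSliceDataD L a m2 i, kSlicePBD L a m2 i, i.j, i.j_succ_le_k, i.Msz, i.one_le_Msz, by show 1 < L; omega⟩

end Object

/-! ## §2 (3.73) lines 1–2 at slice `j` for the datum with gradient, every index -/

section Lines

variable (L : ℕ) [NeZero L]

/-- **(3.73) LINE 1 for the datum with gradient** (its slice kernel is part G's; `d ≥ 1`, `0 ≤ γ ≤ 1`, `γ′ = γ∕2`). [cite: King1986, Prop. 3.9 (3.73) p.665 (first line, `A = 0`)] -/
theorem line1_kSlicesD (hd : 1 ≤ d) (hLodd : Odd L) (hL : 2 ≤ L) {a m2 : ℝ} (ha : 0 < a) (hm : 0 < m2) {γ : ℝ} (hγ0 : 0 ≤ γ)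
    (hγ1 : γ ≤ 1) :
    ∃ C δ : ℝ, 0 < C ∧ 0 < δ ∧ ∀ (i : KSliceIdx d) (x' y' : (kSliceDataD L a m2 i).hi.S),
      |(kSliceDataD L a m2 i).hi.G i.j x' y' - (kSliceDataD L a m2 i).lo.G i.j ((kSliceDataD L a m2 i).pt x') ((kSliceDataD L a m2 i).pt y')|
        ≤ C * ((kSliceDataD L a m2 i).lo.L : ℝ) ^ (-(γ / 2 * (kSliceDataD L a m2 i).lo.k))
          * ((kSliceDataD L a m2 i).lo.slice i.j) ^ ((2 : ℝ) - ((d + 1 : ℕ) : ℝ) - γ / 2)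
          * Real.exp (-(δ * ((kSliceDataD L a m2 i).lo.slice i.j)⁻¹
              * (kSliceDataD L a m2 i).lo.dist ((kSliceDataD L a m2 i).pt x') ((kSliceDataD L a m2 i).pt y'))) :=
  line1_kSlices L hd hLodd hL ha hm hγ0 hγ1

/-- **(3.73) LINE 2 AT SLICE `j` FOR KING'S `A = 0` DATUM, EVERY INDEX AND DIRECTION, ONE `(C, δ)`** (odd `L ≥ 3`, `a, m² > 0`, `0 ≤ γ < 1`,
`γ′ = γ∕2`; every `d`): `|∂^{η′}_μG′_{(j)}(x′, y′) − ∂^η_μG_{(j)}(x, y)| ≤ C·L^{−γ′k}(L^jη)^{1−(d+1)−γ′}·e^{−δ(L^jη)^{−1}dist(x, y)}` — part H's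
`ksDSlice_rate`, the rate rewritten by `slice_rate_identity`, the prefactor `(L^jη)^{−d} ≥ 1` absorbing the lattice-unit `O(1)`.
[cite: King1986, Prop. 3.9 (3.73) p.665 (second line, `A = 0`), (4.42)–(4.43) p.675] -/
theorem line2_kSlicesD (hLodd : Odd L) (hL : 2 ≤ L) {a m2 : ℝ} (ha : 0 < a) (hm : 0 < m2) {γ : ℝ} (hγ0 : 0 ≤ γ) (hγ1 : γ < 1) :
    ∃ C δ : ℝ, 0 < C ∧ 0 < δ ∧ ∀ (i : KSliceIdx d) (x' y' : (kSliceDataD L a m2 i).hi.S) (μ : Fin (d + 1)),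
      |(kSliceDataD L a m2 i).hi.dG i.j μ x' y'
          - (kSliceDataD L a m2 i).lo.dG i.j μ ((kSliceDataD L a m2 i).pt x') ((kSliceDataD L a m2 i).pt y')|
        ≤ C * ((kSliceDataD L a m2 i).lo.L : ℝ) ^ (-(γ / 2 * (kSliceDataD L a m2 i).lo.k))
          * ((kSliceDataD L a m2 i).lo.slice i.j) ^ ((1 : ℝ) - ((d + 1 : ℕ) : ℝ) - γ / 2)
          * Real.exp (-(δ * ((kSliceDataD L a m2 i).lo.slice i.j)⁻¹
              * (kSliceDataD L a m2 i).lo.dist ((kSliceDataD L a m2 i).pt x') ((kSliceDataD L a m2 i).pt y'))) := by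
  have hL0 : 0 < L := by omega
  obtain ⟨C, δ, hC, hδ, H⟩ := ksDSlice_rate (d := d) L hLodd hL ha hm hγ0 hγ1
  refine ⟨C, δ, hC, hδ, fun i x' y' μ => ?_⟩
  have h := H i μ x' y'
  have hsl : (kSliceDataD L a m2 i).lo.slice i.j = (L : ℝ) ^ i.j * eps L i.k := rfl
  obtain ⟨hsl0, hsl1⟩ := kSlice_slice_pos_le_one (L := L) (by omega) (le_of_lt i.j_succ_le_k)
  set sl : ℝ := (L : ℝ) ^ i.j * eps L i.k with hsl_def
  set t : ℝ := tdistT (ksU L i) (blockOf (L ^ i.j) (ksU L i) (underPtN L i.j i.n (ksU L i) x'))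
    (blockOf (L ^ i.j) (ksU L i) (underPtN L i.j i.n (ksU L i) y')) with ht
  have hexp : Real.exp (-(δ * sl⁻¹ * (sl * t))) = Real.exp (-(δ * t)) := by
    rw [mul_assoc, inv_mul_cancel_left₀ hsl0.ne']
  have hrate : ((L : ℝ) ^ (-(γ / 2))) ^ i.j = (L : ℝ) ^ (-(γ / 2 * i.k)) * sl ^ (-(γ / 2)) :=
    (slice_rate_identity L hL0 (γ / 2) i.j i.k).symm
  have hd' : (1 : ℝ) - ((d + 1 : ℕ) : ℝ) - γ / 2 ≤ -(γ / 2) := by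
    have : (0 : ℝ) ≤ d := Nat.cast_nonneg d
    push_cast
    linarith
  have hpref : sl ^ (-(γ / 2)) ≤ sl ^ ((1 : ℝ) - ((d + 1 : ℕ) : ℝ) - γ / 2) :=
    Real.rpow_le_rpow_of_exponent_ge hsl0 hsl1 hd'
  have hLk : 0 ≤ (L : ℝ) ^ (-(γ / 2 * i.k)) := Real.rpow_nonneg (Nat.cast_nonneg _) _
  rw [hsl, hexp]
  calc |ksDSlice' L a m2 i μ x' y' - ksDSlice L a m2 i μ (underPtN L i.j i.n (ksU L i) x') (underPtN L i.j i.n (ksU L i) y')|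
      ≤ C * ((L : ℝ) ^ (-(γ / 2))) ^ i.j * Real.exp (-(δ * t)) := h
    _ = C * ((L : ℝ) ^ (-(γ / 2 * i.k)) * sl ^ (-(γ / 2))) * Real.exp (-(δ * t)) := by rw [hrate]
    _ ≤ C * ((L : ℝ) ^ (-(γ / 2 * i.k)) * sl ^ ((1 : ℝ) - ((d + 1 : ℕ) : ℝ) - γ / 2)) * Real.exp (-(δ * t)) :=
        mul_le_mul_of_nonneg_right (mul_le_mul_of_nonneg_left (mul_le_mul_of_nonneg_left hpref hLk) hC.le) (Real.exp_pos _).le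
    _ = C * (L : ℝ) ^ (-(γ / 2 * i.k)) * sl ^ ((1 : ℝ) - ((d + 1 : ℕ) : ℝ) - γ / 2) * Real.exp (-(δ * t)) := by ring

end Lines

/-! ## §3 Through part E: NE2's site layer for the slice and its gradient, hypothesis-free -/

section Pipeline

variable (L : ℕ) [NeZero L]

/-- `NE2PlusSite (d+1) (−2) c35` for the slice kernel of the datum with gradient (as part G's `ne2PlusSite_kSlices`). [cite: King1986, Prop. 3.9 (3.73) p.665 (first line); Balaban1985BackgroundPropagators, Thm 3.2 (3.48) p.398 + Thm 3.14 pp.426–427 (quantifier template)] -/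
theorem ne2PlusSite_kSlicesD (hd : 1 ≤ d) (hLodd : Odd L) (hL : 2 ≤ L) {a m2 : ℝ} (ha : 0 < a) (hm : 0 < m2) {γ : ℝ} (hγ0 : 0 < γ)
    (hγ1 : γ ≤ 1) (c35 : ℝ) :
    NE2PlusSite (d + 1) (-2) c35 (fun i : KSliceIdx d => slicesInstance (kSliceIndexD L a m2 hL i))
      (fun i => slicesGSite (kSliceIndexD L a m2 hL i)) := by
  obtain ⟨C, δ, hC, hδ, H⟩ := line1_kSlicesD (d := d) L hd hLodd hL ha hm hγ0.le hγ1
  exact ne2PlusSite_slicesG_of_line1 (kSliceIndexD L a m2 hL) hC hδ (half_pos hγ0) H c35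

/-- **`NE2PlusSite (d+1) (−1) c35` FOR THE GRADIENT SLICES OF KING'S `A = 0` MEMBERS, HYPOTHESIS-FREE** (`0 < γ < 1`; constants
`(1, δ, 1, (d+1)·C, γ∕2)`): part E v1.1's `ne2PlusSite_slicesDG_of_line2` fed §2's `line2_kSlicesD` — NE2's `p = −1` site-kernel layer (the gradient
of a covariance) for King's `A = 0` single-scale pieces on every volume, internal slice and spacing ratio. [cite: King1986, Prop. 3.9 (3.73) p.665 (second line); Balaban1985BackgroundPropagators, Thm 3.2 (3.48) p.398 + Thm 3.14 pp.426–427 (quantifier template)] -/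
theorem ne2PlusSite_kSlicesD_grad (hLodd : Odd L) (hL : 2 ≤ L) {a m2 : ℝ} (ha : 0 < a) (hm : 0 < m2) {γ : ℝ} (hγ0 : 0 < γ)
    (hγ1 : γ < 1) (c35 : ℝ) :
    NE2PlusSite (d + 1) (-1) c35 (fun i : KSliceIdx d => slicesInstance (kSliceIndexD L a m2 hL i))
      (fun i => slicesDGSite (kSliceIndexD L a m2 hL i)) := by
  obtain ⟨C, δ, hC, hδ, H⟩ := line2_kSlicesD (d := d) L hLodd hL ha hm hγ0.le hγ1
  exact ne2PlusSite_slicesDG_of_line2 (kSliceIndexD L a m2 hL) (Nat.succ_pos d) hC hδ (half_pos hγ0) H c35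

/-- `NE2ZeroSite (d+1) (−1)` for the gradient slices (the site twin at the one configuration). [cite: King1986, Prop. 3.9 (3.73) p.665 (second line)] -/
theorem ne2ZeroSite_kSlicesD_grad (hLodd : Odd L) (hL : 2 ≤ L) {a m2 : ℝ} (ha : 0 < a) (hm : 0 < m2) {γ : ℝ} (hγ0 : 0 < γ)
    (hγ1 : γ < 1) :
    NE2ZeroSite (d + 1) (-1) (fun i : KSliceIdx d => slicesInstance (kSliceIndexD L a m2 hL i))
      (fun i => slicesDGSite (kSliceIndexD L a m2 hL i)) :=
  ne2ZeroSite_of_ne2PlusSite (c35 := 0) (fun _ _ _ => trivial) (ne2PlusSite_kSlicesD_grad L hLodd hL ha hm hγ0 hγ1 0)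

/-- **BOTH LINES AT ONCE**: for `d ≥ 1` and `0 < γ < 1`, King's `A = 0` members carry NE2's site layer for the slice (`p = −2`) AND for its gradient
(`p = −1`) — the model analogue of the two kernel lines of (3.73) decided, hypothesis-free. [cite: King1986, Prop. 3.9 (3.73) p.665 (lines 1–2)] -/
theorem ne2PlusSite_kSlicesD_both (hd : 1 ≤ d) (hLodd : Odd L) (hL : 2 ≤ L) {a m2 : ℝ} (ha : 0 < a) (hm : 0 < m2) {γ : ℝ}
    (hγ0 : 0 < γ) (hγ1 : γ < 1) (c35 : ℝ) :
    NE2PlusSite (d + 1) (-2) c35 (fun i : KSliceIdx d => slicesInstance (kSliceIndexD L a m2 hL i))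
        (fun i => slicesGSite (kSliceIndexD L a m2 hL i)) ∧
      NE2PlusSite (d + 1) (-1) c35 (fun i : KSliceIdx d => slicesInstance (kSliceIndexD L a m2 hL i))
        (fun i => slicesDGSite (kSliceIndexD L a m2 hL i)) :=
  ⟨ne2PlusSite_kSlicesD L hd hLodd hL ha hm hγ0 hγ1.le c35, ne2PlusSite_kSlicesD_grad L hLodd hL ha hm hγ0 hγ1 c35⟩

end Pipeline

end Summit.QuantumFields.YangMills.BalabanUVNodes.N15KingModelRung.Curved

end
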